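import Summits.CriticalPhenomena.PercolationContinuityZ3.Theorems.SahiMasterFamilyStructPositivity
import Summits.CriticalPhenomena.PercolationContinuityZ3.Theorems.SahiMasterFamilyFrameStep

/-!
# Structure theory of the zero-flag class, IX: zero flags are structured (`Z ⊆ S`)

Unit `prim-master-conj` (crux anchor stmt-CriticalPhenomena-4575); STRUCTURE-THEORY.md §4.2–§4.3 (gen 6).
* `[F]` (`sandwich_of_sahiE_eq_zero`): if `E(μ_p; structured core W, D) = 0` at an interior `p`, then for every `u ∈ W`,
  `(⋂_{w ≠ u} A_w) ∩ hull_{S_F}(D) ⊆ D` (pure replacement lowers `E`, then the tree's frame zero set and frame sandwich).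
* KEY (`mem_cframe_update_inter`): under `[F]`, a configuration of the annihilator of `D` lying in `U t` is annihilated by `U t ∩ D`
  in the shrunk family (rigidity of the two factorisations of its intersection event).
* **EQ⊇** (`structured_of_suppZeroFlag`): every family of the recursive class `SuppZeroFlag` (members nonempty increasing) is
  structured; with `suppZeroFlag_of_structured`: Z_k = S_k.  Axioms standard. [this work]
-/

noncomputable section

open scoped Classical

namespace Summit.CriticalPhenomena.PercolationContinuityZ3.Theorems

open Finset Function MeasureTheory
open Literature.Combinatorics.Sahi2008
open Literature.Probability.LatticeModels (prodBernoulli)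
open Literature.Probability.LatticeModels.Kahn2022 (Affects)
open Literature.Probability.Percolation (DeterminedBy)
open Literature.Probability.Percolation.DecisionTree (ind ind_of_mem ind_of_not_mem ind_nonneg)

variable {ι : Type} [Fintype ι] {κ : Type*} (U : κ → Set (Set ι))

/-! ### Removing annihilated members -/

/-- Removing members all annihilated at one configuration keeps a family structured (C iterated, frames restrict). [this work] -/
theorem structured_sdiff_of_annihilated (hU : ∀ k, IsUpperSet (U k)) (hne : ∀ k, (U k).Nonempty) (ψ : Set ι) :
    ∀ (P F : Finset κ), Structured U F → P ⊆ F → (∀ x ∈ P, ψ ∈ cframe U F x ∧ ψ ∉ U x) → Structured U (F \ P) := by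
  intro P
  induction P using Finset.induction_on with
  | empty => intro F hF _ _; simpa using hF
  | insert x P hxP ih =>
    intro F hF hPF hann
    have hxF : x ∈ F := hPF (mem_insert_self x P)
    have hNx : ¬ (cframe U F x ⊆ U x) := fun h => (hann x (mem_insert_self x P)).2 (h (hann x (mem_insert_self x P)).1)
    have hFx : Structured U (F.erase x) := structured_erase_of_not_subset U hU hne hF hxF hNx
    have e : F \ insert x P = F.erase x \ P := by ext y; simp only [mem_sdiff, mem_insert, mem_erase]; tauto
    rw [e]
    refine ih (F.erase x) hFx (fun y hy => mem_erase.2 ⟨fun h => hxP (h ▸ hy), hPF (mem_insert_of_mem hy)⟩) fun y hy => ?_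
    have hyF : y ∈ F.erase x := mem_erase.2 ⟨fun h => hxP (h ▸ hy), hPF (mem_insert_of_mem hy)⟩
    rw [cframe_erase U hU hne hF hFx hyF]
    exact hann y (mem_insert_of_mem hy)

/-! ### [F]: the frame sandwich from `E = 0` -/

omit [Fintype ι] in
/-- Slot bookkeeping: all slots but `s.succAbove j'` = the free slot and the other frame slots. [this work] -/
theorem biInter_erase_succAbove {n : ℕ} (F : Fin (n + 2) → Set (Set ι)) (s : Fin (n + 2)) (j' : Fin (n + 1)) :
    (⋂ l ∈ (univ.erase (s.succAbove j') : Finset (Fin (n + 2))), F l) =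
      F s ∩ ⋂ l' ∈ (univ.erase j' : Finset (Fin (n + 1))), F (s.succAbove l') := by
  ext ω
  simp only [Set.mem_iInter, mem_erase, mem_univ, and_true, Set.mem_inter_iff]
  constructor
  · intro h
    exact ⟨h s (Fin.succAbove_ne s j').symm, fun l' hl' => h _ fun e => hl' (Fin.succAbove_right_injective e)⟩
  · rintro ⟨hs, h⟩ l hl
    by_cases hls : l = s
    · rw [hls]; exact hs
    · obtain ⟨l', rfl⟩ := Fin.exists_succAbove_eq hls
      exact h l' fun e => hl (by rw [e])

/-- **[F] (STRUCTURE-THEORY 4.2)**: `E = 0` (interior `p`) forces `(⋂_{w ∈ W ∖ u} cframe w) ∩ hull (frameSupp l) (U d) ⊆ U d`. [this work] -/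
theorem sandwich_of_sahiE_eq_zero (p : ι → unitInterval) (hp : ∀ e, (p e : ℝ) ∈ Set.Ioo (0 : ℝ) 1) (hU : ∀ k, IsUpperSet (U k))
    (hne : ∀ k, (U k).Nonempty) {W : Finset κ} {d : κ} (hd : d ∉ W) (hW : Structured U W) {l : List κ} (hlW : l.toFinset = W)
    (hl : GoodChain U l) {c : ℕ} (V : Fin c → κ) (hV : Injective V) (himg : univ.image V = insert d W)
    (h0 : sahiE (bernoulliWeight p) c (fun j => ind (U (V j))) = 0) {u : κ} (hu : u ∈ W) :
    (⋂ w ∈ W.erase u, cframe U W w) ∩ hull (frameSupp U l) (U d) ⊆ U d := by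
  have hWne : W.Nonempty := ⟨u, hu⟩
  -- sizes and the free slot
  have hc : c = W.card + 1 := by
    have := card_image_of_injective univ hV
    rw [card_univ, Fintype.card_fin, himg, card_insert_of_notMem hd] at this; exact this.symm
  obtain ⟨n, rfl⟩ : ∃ n, c = n + 2 := ⟨c - 2, by have := hWne.card_pos; omega⟩
  have hmemV : ∀ x ∈ insert d W, ∃ j, V j = x := fun x hx => by
    have : x ∈ univ.image V := by rw [himg]; exact hx
    simpa [mem_image] using this
  obtain ⟨s, hs⟩ := hmemV d (mem_insert_self d W)
  -- the pure replacement has `E = 0`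
  set F : Fin (n + 2) → Set (Set ι) := fun j => pureRepl U W (V j) with hFdef
  have hFu : ∀ j, IsUpperSet (F j) := fun j => by
    simp only [hFdef, pureRepl]; split_ifs
    · exact isUpperSet_cframe U hU W _
    · exact hU _
  have hVW : ∀ j, j ≠ s → V j ∈ W := fun j hj =>
    (mem_insert.1 (himg ▸ mem_image_of_mem V (mem_univ j))).resolve_left (fun h => hj (hV (h.trans hs.symm)))
  have hFd : ∀ j j', j ≠ s → j' ≠ s → j ≠ j' → Disjoint (esupp (F j)) (esupp (F j')) := by
    intro j j' hj hj' hjj'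
    simp only [hFdef, pureRepl, hVW j hj, hVW j' hj', if_true]
    exact disjoint_esupp_cframe U hU hne hW (hVW j hj) (hVW j' hj') (fun h => hjj' (hV h))
  have hF0 : sahiE (bernoulliWeight p) (n + 2) (fun j => ind (F j)) = 0 :=
    le_antisymm (by rw [← h0]; exact sahiE_pureRepl_le U p hU hne hd hW hWne V hV himg)
      (sahiE_ind_nonneg_of_frame p F hFu s hFd)
  have HD := disjoint_of_sahiE_frame_eq_zero p hp F hFu s hFd hF0
  -- the frame indexed by `Fin (n+1)`
  set Vm : Fin (n + 1) → κ := fun j => V (s.succAbove j) with hVmdef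
  have hVmW : ∀ j, Vm j ∈ W := fun j => hVW _ (Fin.succAbove_ne s j)
  have hVm : Injective Vm := fun a b h => Fin.succAbove_right_injective (hV h)
  set A : Fin (n + 1) → Set (Set ι) := fun j => cframe U W (Vm j) with hAdef
  have hAu : ∀ j, IsUpperSet (A j) := fun j => isUpperSet_cframe U hU W _
  have hAne : ∀ j, (A j).Nonempty := fun j => (hne _).mono (subset_cframe U hU W _)
  have hFs : F s = U d := by simp [hFdef, pureRepl, hs, hd]
  have hFA : ∀ j', F (s.succAbove j') = A j' := fun j' => by
    have hm : V (s.succAbove j') ∈ W := hVmW j'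
    simp only [hFdef, hAdef, hVmdef, pureRepl, hm, if_true]
  have hc' : ∀ j', Disjoint (esupp (A j')) (esupp (U d ∩ ⋂ l' ∈ (univ.erase j' : Finset (Fin (n + 1))), A l')) := by
    intro j'
    have h := HD (s.succAbove j') (Fin.succAbove_ne s j')
    rw [biInter_erase_succAbove, hFs, hFA] at h
    simp only [hFA] at h
    exact h
  have sand := frame_sandwich_of_disjoint A hAu hAne (hU d) hc'
  -- `u = Vm j₀`
  obtain ⟨j, hj⟩ := hmemV u (mem_insert_of_mem hu)
  have hjs : j ≠ s := fun h => hd (by rw [← hj, h, hs] at hu; exact hu)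
  obtain ⟨j₀, rfl⟩ := Fin.exists_succAbove_eq hjs
  -- translate
  have eS : (↑(univ.biUnion fun l' => esupp (A l')) : Set ι) = frameSupp U l := by
    rw [frameSupp_eq_biUnion_cframe U hU hne hl, hlW, coe_biUnion]
    ext i
    simp only [coe_univ, Set.mem_univ, Set.iUnion_true, Set.mem_iUnion, mem_coe]
    constructor
    · rintro ⟨l', hi⟩; exact ⟨Vm l', hVmW l', by simpa [hAdef] using hi⟩
    · rintro ⟨w, hw, hi⟩
      obtain ⟨jw, hjw⟩ := hmemV w (mem_insert_of_mem hw)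
      have hjws : jw ≠ s := fun h => hd (by rw [← hjw, h, hs] at hw; exact hw)
      obtain ⟨l', rfl⟩ := Fin.exists_succAbove_eq hjws
      exact ⟨l', by simpa [hAdef, hVmdef, hjw] using hi⟩
  have eI : (⋂ l' ∈ (univ.erase j₀ : Finset (Fin (n + 1))), A l') = ⋂ w ∈ W.erase (Vm j₀), cframe U W w := by
    ext ω
    simp only [Set.mem_iInter, mem_erase, mem_univ, and_true]
    constructor
    · intro h w hw
      obtain ⟨jw, hjw⟩ := hmemV w (mem_insert_of_mem hw.2)
      have hjws : jw ≠ s := fun h' => hd (by rw [← hjw, h', hs] at hw; exact hw.2)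
      obtain ⟨l', rfl⟩ := Fin.exists_succAbove_eq hjws
      have : ω ∈ A l' := h l' (fun e => hw.1 (by rw [← hjw, e]))
      simpa [hAdef, hVmdef, hjw] using this
    · intro h l' hl'
      exact h (Vm l') ⟨fun e => hl' (hVm e), hVmW l'⟩
  have hj' : Vm j₀ = u := hj
  intro ω hω
  rw [← hj', ← eI] at hω
  refine sand j₀ ⟨hω.1, ?_⟩
  simp only [Set.mem_setOf_eq, eS]
  exact hω.2

/-- **[F], counting form**: a configuration annihilated by the free event fails at least two canonical frames. [this work] -/
theorem two_le_card_cfail_of_sahiE_eq_zero (p : ι → unitInterval) (hp : ∀ e, (p e : ℝ) ∈ Set.Ioo (0 : ℝ) 1)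
    (hU : ∀ k, IsUpperSet (U k)) (hne : ∀ k, (U k).Nonempty) {W : Finset κ} {d : κ} (hd : d ∉ W) (hW : Structured U W)
    (hWne : W.Nonempty) {l : List κ} (hlW : l.toFinset = W) (hl : GoodChain U l) {c : ℕ} (V : Fin c → κ) (hV : Injective V)
    (himg : univ.image V = insert d W) (h0 : sahiE (bernoulliWeight p) c (fun j => ind (U (V j))) = 0) {ψ : Set ι}
    (hψA : ψ ∈ hull (frameSupp U l) (U d)) (hψD : ψ ∉ U d) : 2 ≤ (cfail U W ψ).card := by
  by_contra hlt
  -- at most one frame fails: pick `u` containing the failures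
  obtain ⟨u, hu, hsub⟩ : ∃ u ∈ W, cfail U W ψ ⊆ {u} := by
    rcases (cfail U W ψ).eq_empty_or_nonempty with h | ⟨u, hu⟩
    · obtain ⟨u, hu⟩ := hWne; exact ⟨u, hu, by rw [h]; exact empty_subset _⟩
    · refine ⟨u, ((mem_cfail U).1 hu).1, fun x hx => mem_singleton.2 ?_⟩
      exact card_le_one.1 (by omega) x hx u hu
  refine hψD (sandwich_of_sahiE_eq_zero U p hp hU hne hd hW hlW hl V hV himg h0 hu ⟨?_, hψA⟩)
  refine Set.mem_iInter₂.2 fun w hw => ?_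
  by_contra hψw
  have : w ∈ cfail U W ψ := (mem_cfail U).2 ⟨mem_of_mem_erase hw, hψw⟩
  exact ne_of_mem_erase hw (mem_singleton.1 (hsub this))

/-! ### KEY: the shrunk member annihilates -/

/-- **KEY (STRUCTURE-THEORY 4.3(a))**: under `[F]`, with the shrunk family `U t ↦ U t ∩ U d` structured on `W`, every configuration of
the annihilator of `U d` lying in `U t` lies in the canonical frame of `t` in the shrunk family. [this work] -/
theorem mem_cframe_update_inter (hU : ∀ k, IsUpperSet (U k)) (hne : ∀ k, (U k).Nonempty) {W : Finset κ} (hW : Structured U W)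
    {l : List κ} (hlW : l.toFinset = W) (hl : GoodChain U l) {d : κ} (hd : d ∉ W)
    (hF : ∀ u ∈ W, (⋂ w ∈ W.erase u, cframe U W w) ∩ hull (frameSupp U l) (U d) ⊆ U d) {t : κ} (ht : t ∈ W)
    (hXt : Structured (update U t (U t ∩ U d)) W) {ψ : Set ι} (hψA : ψ ∈ hull (frameSupp U l) (U d)) (hψt : ψ ∈ U t) :
    ψ ∈ cframe (update U t (U t ∩ U d)) W t := by
  set U' := update U t (U t ∩ U d) with hU'def
  set AM := hull (frameSupp U l) (U d) with hAMdef
  have hU'u : ∀ k, IsUpperSet (U' k) := isUpperSet_update_inter_family U hU t (hU d)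
  have hU'ne : ∀ k, (U' k).Nonempty := nonempty_update_inter_family U hU hne t (hU d) (hne d)
  have hAMu : IsUpperSet AM := isUpperSet_hull (hU d) _
  have hAMd : U d ⊆ AM := subset_hull (hU d) _
  have hS : frameSupp U l = ⋃ w ∈ W, (↑(esupp (cframe U W w)) : Set ι) := by rw [frameSupp_eq_biUnion_cframe U hU hne hl, hlW]
  have hAMdisj : ∀ w ∈ W, Disjoint (esupp AM) (esupp (cframe U W w)) := by
    intro w hw
    refine Finset.disjoint_left.2 fun i hiM hiw => ?_
    have hiS : i ∈ frameSupp U l := by rw [hS]; exact Set.mem_iUnion₂.2 ⟨w, hw, mem_coe.2 hiw⟩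
    exact not_affects_hull (U d) hiS (mem_esupp.1 hiM)
  -- the two factorisations of `(X_t)_∩`
  obtain ⟨l', hl'W, hl'⟩ := id hXt
  have eP₁ : (⋂ w ∈ W, cframe U' W w) = (⋂ w ∈ W, cframe U W w) ∩ AM := by
    rw [← biInter_eq_biInter_cframe U' hU'u hU'ne hXt, ← biInter_eq_biInter_cframe U hU hne hW]
    ext ω
    simp only [Set.mem_iInter, Set.mem_inter_iff]
    constructor
    · intro h
      have hω : ∀ w ∈ W, ω ∈ U w := fun w hw => by
        have := h w hw
        by_cases hwt : w = t
        · subst hwt; rw [hU'def, update_self] at this; exact this.1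
        · rwa [hU'def, update_of_ne hwt] at this
      refine ⟨hω, ?_⟩
      have := h t ht; rw [hU'def, update_self] at this
      exact hAMd this.2
    · rintro ⟨hω, hωM⟩ w hw
      have hωd : ω ∈ U d :=
        hF t ht ⟨Set.mem_iInter₂.2 fun w hw => subset_cframe U hU W w (hω w (mem_of_mem_erase hw)), hωM⟩
      by_cases hwt : w = t
      · subst hwt; rw [hU'def, update_self]; exact ⟨hω w hw, hωd⟩
      · rw [hU'def, update_of_ne hwt]; exact hω w hw
  -- second factorisation as a family over `insert d W`
  set B : κ → Set (Set ι) := fun x => if x ∈ W then cframe U W x else AM with hBdef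
  have hBW : ∀ w ∈ W, B w = cframe U W w := fun w hw => by simp [hBdef, hw]
  have hBd : B d = AM := by simp [hBdef, hd]
  have eP₂ : (⋂ w ∈ W, cframe U' W w) = ⋂ x ∈ insert d W, B x := by
    rw [eP₁, set_biInter_insert, hBd, Set.inter_comm]
    congr 1
    exact Set.iInter₂_congr fun w hw => (hBW w hw).symm
  have hA'u : ∀ j ∈ W, IsUpperSet (cframe U' W j) := fun j _ => isUpperSet_cframe U' hU'u W j
  have hA'ne : ∀ j ∈ W, (cframe U' W j).Nonempty := fun j _ => (hU'ne j).mono (subset_cframe U' hU'u W j)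
  have hA'd : ∀ j ∈ W, ∀ j' ∈ W, j ≠ j' → Disjoint (esupp (cframe U' W j)) (esupp (cframe U' W j')) :=
    fun j hj j' hj' hjj' => disjoint_esupp_cframe U' hU'u hU'ne hXt hj hj' hjj'
  have hBu : ∀ x ∈ insert d W, IsUpperSet (B x) := fun x _ => by
    simp only [hBdef]; split_ifs; exacts [isUpperSet_cframe U hU W x, hAMu]
  have hBdisj : ∀ x ∈ insert d W, ∀ x' ∈ insert d W, x ≠ x' → Disjoint (esupp (B x)) (esupp (B x')) := by
    intro x hx x' hx' hxx'
    rcases mem_insert.1 hx with rfl | hxW <;> rcases mem_insert.1 hx' with rfl | hx'W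
    · exact absurd rfl hxx'
    · rw [hBd, hBW x' hx'W]; exact hAMdisj x' hx'W
    · rw [hBd, hBW x hxW]; exact (hAMdisj x hxW).symm
    · rw [hBW x hxW, hBW x' hx'W]; exact disjoint_esupp_cframe U hU hne hW hxW hx'W hxx'
  -- blocks of `cframe U' W t` and `cframe U W t'` do not meet for `t' ≠ t`
  have cross : ∀ t' ∈ W, t' ≠ t → Disjoint (esupp (cframe U' W t)) (esupp (cframe U W t')) := by
    intro t' ht' htt'
    rw [Finset.disjoint_iff_inter_eq_empty]
    by_contra hP
    have hPne : (esupp (cframe U' W t) ∩ esupp (B t')).Nonempty := by rw [hBW t' ht']; exact nonempty_iff_ne_empty.2 hP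
    have rig := compl_notMem_of_two_factorisations (fun w => cframe U' W w) W B (insert d W) hA'u hA'ne hA'd hBu hBdisj eP₂ ht
      (mem_insert_of_mem ht') hPne
    apply rig
    set P : Finset ι := esupp (cframe U' W t) ∩ esupp (B t') with hPdef
    have hPt : P ⊆ esupp (cframe U' W t) := inter_subset_left
    have hPt' : P ⊆ esupp (cframe U W t') := by rw [hPdef, hBW t' ht']; exact inter_subset_right
    -- `Pᶜ` lies in every `U'`-frame except possibly that of `t`, and in every `U`-frame except possibly that of `t'`
    have inA' : ∀ w ∈ W, w ≠ t → ((↑P)ᶜ : Set ι) ∈ cframe U' W w := by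
      intro w hw hwt
      refine mem_of_esupp_subset (isUpperSet_cframe U' hU'u W w) ((hU'ne w).mono (subset_cframe U' hU'u W w)) fun i hi => ?_
      rw [Set.mem_compl_iff, mem_coe]
      exact fun hiP => Finset.disjoint_left.1 (disjoint_esupp_cframe U' hU'u hU'ne hXt ht hw (Ne.symm hwt)) (hPt hiP) hi
    have inA : ∀ w ∈ W, w ≠ t' → ((↑P)ᶜ : Set ι) ∈ cframe U W w := by
      intro w hw hwt'
      refine mem_of_esupp_subset (isUpperSet_cframe U hU W w) ((hne w).mono (subset_cframe U hU W w)) fun i hi => ?_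
      rw [Set.mem_compl_iff, mem_coe]
      exact fun hiP => Finset.disjoint_left.1 (disjoint_esupp_cframe U hU hne hW ht' hw (Ne.symm hwt')) (hPt' hiP) hi
    have inAM : ((↑P)ᶜ : Set ι) ∈ AM := by
      refine mem_of_esupp_subset hAMu ((hne d).mono hAMd) fun i hi => ?_
      rw [Set.mem_compl_iff, mem_coe]
      exact fun hiP => Finset.disjoint_left.1 (hAMdisj t' ht') hi (hPt' hiP)
    -- T″ in both families (via chains)
    have memU_of_ne_t : ∀ w ∈ W, w ≠ t → ((↑P)ᶜ : Set ι) ∈ U' w := by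
      intro w hw hwt
      have hwl' : w ∈ l' := List.mem_toFinset.1 (by rw [hl'W]; exact hw)
      refine mem_of_frameFail_card_le_one U' hl' hU'u (frameFail_card_le_one_of_forall U' t fun u hu hut => ?_) hwl' ?_
      · rw [frameIn_eq_cframe U' hU'u hU'ne hl' hu, hl'W]; exact inA' u (hl'W ▸ List.mem_toFinset.2 hu) hut
      · rw [frameIn_eq_cframe U' hU'u hU'ne hl' hwl', hl'W]; exact inA' w hw hwt
    have memU_of_ne_t' : ∀ w ∈ W, w ≠ t' → ((↑P)ᶜ : Set ι) ∈ U w := by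
      intro w hw hwt'
      have hwl : w ∈ l := List.mem_toFinset.1 (by rw [hlW]; exact hw)
      refine mem_of_frameFail_card_le_one U hl hU (frameFail_card_le_one_of_forall U t' fun u hu hut => ?_) hwl ?_
      · rw [frameIn_eq_cframe U hU hne hl hu, hlW]; exact inA u (hlW ▸ List.mem_toFinset.2 hu) hut
      · rw [frameIn_eq_cframe U hU hne hl hwl, hlW]; exact inA w hw hwt'
    -- hence `Pᶜ ∈ ⋂_W cframe U' W` (= `⋂_W U'`)
    rw [← biInter_eq_biInter_cframe U' hU'u hU'ne hXt]
    refine Set.mem_iInter₂.2 fun w hw => ?_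
    by_cases hwt : w = t
    · subst hwt
      rw [hU'def, update_self]
      refine ⟨memU_of_ne_t' w hw (Ne.symm htt'), hF t' ht' ⟨?_, inAM⟩⟩
      exact Set.mem_iInter₂.2 fun x hx => inA x (mem_of_mem_erase hx) (ne_of_mem_erase hx)
    · exact memU_of_ne_t w hw hwt
  -- conclusion: lift `ψ` by the other blocks; the lift lies in the product, hence in the frame of `t`
  set ξ : Set ι := ψ ∪ ⋃ w ∈ W.erase t, (↑(esupp (cframe U W w)) : Set ι) with hξdef
  have hξ : ξ ∈ ⋂ w ∈ W, cframe U' W w := by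
    rw [eP₁]
    refine ⟨Set.mem_iInter₂.2 fun w hw => ?_, hAMu Set.subset_union_left hψA⟩
    by_cases hwt : w = t
    · subst hwt; exact isUpperSet_cframe U hU W w Set.subset_union_left (subset_cframe U hU W w hψt)
    · refine mem_of_esupp_subset (isUpperSet_cframe U hU W w) ((hne w).mono (subset_cframe U hU W w)) fun i hi => ?_
      exact Set.mem_union_right _ (Set.mem_iUnion₂.2 ⟨w, mem_erase.2 ⟨hwt, hw⟩, hi⟩)
  have hξt : ξ ∈ cframe U' W t := (Set.mem_iInter₂.1 hξ) t ht
  refine (mem_iff_of_inter_esupp_eq (isUpperSet_cframe U' hU'u W t) ?_).2 hξt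
  ext i
  simp only [Set.mem_inter_iff, hξdef, Set.mem_union, Set.mem_iUnion₂, mem_coe]
  constructor
  · rintro ⟨hi, hiA⟩; exact ⟨Or.inl hi, hiA⟩
  · rintro ⟨hi | ⟨w, hw, hiw⟩, hiA⟩
    · exact ⟨hi, hiA⟩
    · exact absurd hiw (Finset.disjoint_left.1 (cross w (mem_of_mem_erase hw) (ne_of_mem_erase hw)) hiA)

/-! ### Zero flags are structured -/

/-- **EQ⊇ (STRUCTURE-THEORY 4.3): every family in the recursive zero-flag class `SuppZeroFlag` is structured** (members nonempty
increasing, any injective enumeration). [this work] -/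
theorem structured_of_suppZeroFlag : ∀ (k : ℕ) (U : κ → Set (Set ι)), (∀ x, IsUpperSet (U x)) → (∀ x, (U x).Nonempty) →
    ∀ (V : Fin (k + 2) → κ), Injective V → SuppZeroFlag (k + 2) (fun j => U (V j)) → Structured U (univ.image V)
  | 0, U, hU, _, V, hV, hZ => by
    obtain ⟨S, T, hST, hS, hT⟩ := hZ
    have h01 : V 0 ≠ V 1 := fun h => absurd (hV h) (by decide)
    have hd : Disjoint (esupp (U (V 0))) (esupp (U (V 1))) :=
      Finset.disjoint_of_subset_left (esupp_subset_of_determinedBy hS)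
        (Finset.disjoint_of_subset_right (esupp_subset_of_determinedBy hT) hST)
    refine ⟨[V 0, V 1], ?_, (goodChain_pair_iff U hU h01).2 hd⟩
    ext x; simp only [List.toFinset_cons, List.toFinset_nil, insert_empty_eq, mem_insert, mem_singleton, mem_image, mem_univ, true_and]
    constructor
    · rintro (rfl | rfl); exacts [⟨0, rfl⟩, ⟨1, rfl⟩]
    · rintro ⟨j, rfl⟩; fin_cases j <;> simp
  | k + 1, U, hU, hne, V, hV, hZ => by
    obtain ⟨i, h1, h2⟩ := hZ
    set Vm : Fin (k + 2) → κ := fun j => V (i.succAbove j) with hVmdef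
    have hVm : Injective Vm := fun a b h => Fin.succAbove_right_injective (hV h)
    set W := univ.image Vm with hWdef
    set d := V i with hddef
    have hdW : d ∉ W := by
      rw [hWdef, mem_image]; rintro ⟨j, -, hj⟩; exact Fin.succAbove_ne i j (hV hj)
    have himg : univ.image V = insert d W := by
      rw [hWdef, hVmdef, image_succAbove_eq_erase V hV i, insert_erase (mem_image_of_mem V (mem_univ i))]
    -- the core and its shrinks are structured (induction)
    have hW : Structured U W := structured_of_suppZeroFlag k U hU hne Vm hVm h1
    have hWne : W.Nonempty := ⟨Vm 0, mem_image_of_mem Vm (mem_univ 0)⟩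
    obtain ⟨l, hlW, hl⟩ := id hW
    have hX : ∀ t ∈ W, Structured (update U t (U t ∩ U d)) W := by
      intro t ht
      obtain ⟨jt, -, hjt⟩ := mem_image.1 ht
      have hU'u := isUpperSet_update_inter_family U hU t (hU d)
      have hU'ne := nonempty_update_inter_family U hU hne t (hU d) (hne d)
      refine structured_of_suppZeroFlag k _ hU'u hU'ne Vm hVm ?_
      have e : (fun j => update U t (U t ∩ U d) (Vm j)) = update (fun j => U (V (i.succAbove j))) jt (U (V (i.succAbove jt)) ∩ U (V i)) := by
        funext j
        by_cases hj : j = jt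
        · subst hj; rw [update_self, ← hjt, update_self]
        · rw [update_of_ne hj, update_of_ne (fun h => hj (hVm (h.trans hjt.symm)))]
      rw [e]; exact h2 jt
    -- `E = 0` at the midpoint parameters, hence [F]
    have h0 : sahiE (bernoulliWeight (halfParams ι)) (k + 3) (fun j => ind (U (V j))) = 0 :=
      sahiE_ind_eq_zero_of_suppZeroFlag _ ⟨i, h1, h2⟩
    have hF : ∀ u ∈ W, (⋂ w ∈ W.erase u, cframe U W w) ∩ hull (frameSupp U l) (U d) ⊆ U d := fun u hu =>
      sandwich_of_sahiE_eq_zero U (halfParams ι) (halfParams_mem_Ioo ι) hU hne hdW hW hlW hl V hV himg h0 hu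
    -- the annihilator of `d` over the chain `l` is safe
    have hgood : GoodChain U (d :: l) := by
      rw [goodChain_cons]
      refine ⟨hl, fun h => hdW (hlW ▸ List.mem_toFinset.2 h), fun ψ hψ => ?_⟩
      obtain ⟨hψA, hψD⟩ := hψ
      rw [hlW, mem_safe_iff_cfail U hU hne hW]
      refine ⟨two_le_card_cfail_of_sahiE_eq_zero U (halfParams ι) (halfParams_mem_Ioo ι) hU hne hdW hW hWne hlW hl V hV himg h0
        hψA hψD, fun R hR1 hR2 => ?_⟩
      by_cases hex : ∃ t ∈ W, t ∉ R ∧ ψ ∈ U t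
      · -- KEY at `t`, then C + SYM + T1 in `W ∖ t`
        obtain ⟨t, ht, htR, hψt⟩ := hex
        set U' := update U t (U t ∩ U d) with hU'def
        have hU'u := isUpperSet_update_inter_family U hU t (hU d)
        have hU'ne := nonempty_update_inter_family U hU hne t (hU d) (hne d)
        have hkey : ψ ∈ cframe U' W t := mem_cframe_update_inter U hU hne hW hlW hl hdW hF ht (hX t ht) hψA hψt
        have hN' : ¬ (cframe U' W t ⊆ U' t) := fun h => by
          have := h hkey; rw [hU'def, update_self] at this; exact hψD this.2
        have hWt' : Structured U' (W.erase t) := structured_erase_of_not_subset U' hU'u hU'ne (hX t ht) ht hN'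
        have hagree : ∀ w ∈ W.erase t, U' w = U w := fun w hw => by rw [hU'def, update_of_ne (ne_of_mem_erase hw)]
        have hWt : Structured U (W.erase t) := (structured_congr hagree).1 hWt'
        have hsafe' := annihilator_subset_safe_erase U' hU'u hU'ne (hX t ht) ht hWt'
        have hψs : ψ ∈ Safe U (W.erase t) := by
          rw [← safe_congr (fun w hw => (hagree w hw))]; refine hsafe' ⟨hkey, fun h => ?_⟩
          rw [hU'def, update_self] at h; exact hψD h.2
        obtain ⟨-, hsup⟩ := (mem_safe_iff_cfail U hU hne hWt ψ).1 hψs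
        refine hsup R (fun w hw => hR1 ?_) (fun x hx => mem_erase.2 ⟨fun h => htR (h ▸ hx), hR2 hx⟩)
        rw [mem_cfail] at hw ⊢
        refine ⟨mem_of_mem_erase hw.1, ?_⟩
        rw [← cframe_erase U hU hne hW hWt hw.1]
        exact hw.2
      · -- every member outside `R` is annihilated at `ψ`: remove them
        push Not at hex
        have e : R = W \ (W \ R) := by
          rw [sdiff_sdiff_right_self, inf_eq_right.2 hR2]
        rw [e]
        refine structured_sdiff_of_annihilated U hU hne ψ (W \ R) W hW sdiff_subset fun x hx => ?_
        rw [mem_sdiff] at hx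
        have hψx : ψ ∉ U x := hex x hx.1 hx.2
        refine ⟨?_, hψx⟩
        by_contra hcf
        exact hx.2 (hR1 ((mem_cfail U).2 ⟨hx.1, hcf⟩))
    rw [himg, ← hlW, ← List.toFinset_cons]
    exact ⟨d :: l, rfl, hgood⟩

end Summit.CriticalPhenomena.PercolationContinuityZ3.Theorems
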